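import Mathlib
import Summits.MatrixMultiplication.MatrixMultiplication.Theorems.SnSubsetDichotomyHyperoctahedralSubsetsRematch

/-!
# `SnSubsetDichotomy.HyperoctahedralThreshold`, line `refutation-local-symmetry` — sparse cuts are recursible
# in the forbidden-set form of the one-gadget lemma (helper for the open core `stub_poorRigidCore`)

Crux `stmt-MatrixMultiplication-10883`; siege seat k8 (`--supports`).  The conclusion of the open core
`stub_poorRigidCore` (skeleton `Cruxes/HyperoctahedralThreshold/Lines/refutation_local_symmetry.lean`) is the
ONE-GADGET statement in its forbidden-set form: three fixed-point-free involutions `μ c` of `Fin n` and a forbidden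
set `R` with `|R| ≤ n^{3/4}` admit a closed colour-walk of the rung graph — `k + 1` rungs `{p i, q i}`, steps of
colour `col i` mapping rung `i` onto rung `i + 1` as a set, consecutive colours distinct (cyclically), rungs
pairwise equal-or-disjoint — all of whose points avoid `R`, with `k + 1 ≤ n^{1/4}`.  Call this `OGL(n, μ, R)`.

This file proves the SURGERY STEP for that statement (crux NOTES §D1 records the step for the bulk form and doubts
it for the `R`-form; the doubt is unfounded for the ONE-gadget statement, by the concavity slack below):

* `SparseCut.transport_side` — if `μ'` are fixed-point-free involutions leaving a vertex set `P` invariant and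
  agreeing with `μ` at every vertex whose `μ c`-partner is on the same side (the re-matched host of the sibling's
  `stub_rematch`, p103260), if `OGL` holds for the sub-host on `P` (transported to `Fin |P|`) with every forbidden
  set of size `≤ |P|^{3/4}`, and if the BUDGET `|R ∩ P| + |∂P| ≤ |P|^{3/4}` holds (`∂P` = the vertices of `P` with a
  `μ`-neighbour outside `P`, the only vertices where `μ'` may differ from `μ`), then `OGL(n, μ, R)`: the walk found
  in the sub-host avoids `∂P`, so every step it uses is a genuine `μ`-edge, and `|P|^{1/4} ≤ n^{1/4}`.
* `SparseCut.key_ineq` — the concavity slack `n^{3/4} − (7/8)s^{3/4} ≤ (n − s)^{3/4}` for `0 ≤ s ≤ n/2`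
  (from `(1 − t)^{3/4} ≥ 1 − t` and `t^{1/4} ≤ (1/2)^{1/4} ≤ 7/8`).
* `sparseCut_oneGadget` — for `S` of even size `s ≤ n/2` whose two boundary layers have at most `s^{3/4}/16`
  vertices each, `OGL` for the two sides (sizes `s` and `n − s`, as hypotheses — the strong-induction hypotheses
  of a future proof of the core) implies `OGL(n, μ, R)`: either `|R ∩ S| + |∂S| ≤ s^{3/4}` and the `S`-side works,
  or `|R ∩ S| > (15/16)s^{3/4}` and then `|R ∩ Sᶜ| + |∂Sᶜ| < n^{3/4} − (7/8)s^{3/4} ≤ (n − s)^{3/4}` and the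
  complement works.

Consequence for the open core: in a proof of `stub_poorRigidCore` by strong induction on `n` the host may be
assumed to have `|∂S| > |S|^{3/4}/16` for every even `S` with `n₀ ≤ |S| ≤ n/2` (an `|S|^{−1/4}`-conductance bound at
all polynomial scales).  Pure finite combinatorics plus one real inequality. [this line; folklore]
-/

-- the project's summit namespace `Summit.MatrixMultiplication.MatrixMultiplication` repeats a component by design (D-0022)
set_option linter.dupNamespace false

namespace Summit.MatrixMultiplication.MatrixMultiplication.Theorems.HyperoctahedralThreshold

open Finset

namespace SparseCut

/-- **Concavity slack.**  For `0 ≤ s ≤ n/2`: `n^{3/4} − (7/8)·s^{3/4} ≤ (n − s)^{3/4}`.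
Proof: with `t = s/n ∈ [0, 1/2]`, `(n − s)^{3/4} = n^{3/4}(1 − t)^{3/4} ≥ n^{3/4}(1 − t)` and
`n^{3/4} t = s^{3/4} t^{1/4} ≤ (7/8) s^{3/4}` because `t ≤ 1/2 ≤ (7/8)^4`. [folklore] -/
theorem key_ineq {s n : ℝ} (hs : 0 ≤ s) (h2 : 2 * s ≤ n) :
    n ^ ((3 : ℝ) / 4) - 7 / 8 * s ^ ((3 : ℝ) / 4) ≤ (n - s) ^ ((3 : ℝ) / 4) := by
  rcases eq_or_lt_of_le hs with h0 | hs0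
  · subst h0
    simp [Real.zero_rpow (by norm_num : ((3 : ℝ) / 4) ≠ 0)]
  have hn : 0 < n := by linarith
  set t : ℝ := s / n with ht
  have ht0 : 0 < t := div_pos hs0 hn
  have ht1 : t ≤ 1 / 2 := by
    rw [ht, div_le_iff₀ hn]; linarith
  have hst : s = n * t := by rw [ht]; field_simp
  have hns : n - s = n * (1 - t) := by rw [hst]; ring
  -- (n - s)^{3/4} = n^{3/4} (1 - t)^{3/4} ≥ n^{3/4} (1 - t)
  have h1 : (n - s) ^ ((3 : ℝ) / 4) = n ^ ((3 : ℝ) / 4) * (1 - t) ^ ((3 : ℝ) / 4) := by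
    rw [hns, Real.mul_rpow hn.le (by linarith)]
  have h2 : 1 - t ≤ (1 - t) ^ ((3 : ℝ) / 4) :=
    Real.self_le_rpow_of_le_one (by linarith) (by linarith) (by norm_num)
  have hn34 : 0 ≤ n ^ ((3 : ℝ) / 4) := Real.rpow_nonneg hn.le _
  have h3 : n ^ ((3 : ℝ) / 4) * (1 - t) ≤ (n - s) ^ ((3 : ℝ) / 4) := by
    rw [h1]; exact mul_le_mul_of_nonneg_left h2 hn34
  -- n^{3/4} t = s^{3/4} t^{1/4}
  have h4 : n ^ ((3 : ℝ) / 4) * t = s ^ ((3 : ℝ) / 4) * t ^ ((1 : ℝ) / 4) := by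
    rw [hst, Real.mul_rpow hn.le ht0.le, mul_assoc, ← Real.rpow_add ht0]
    norm_num
  -- t^{1/4} ≤ 7/8
  have h5 : t ^ ((1 : ℝ) / 4) ≤ 7 / 8 := by
    have h78 : ((7 / 8 : ℝ) ^ (4 : ℕ)) ^ ((1 : ℝ) / 4) = 7 / 8 := by
      rw [← Real.rpow_natCast, ← Real.rpow_mul (by norm_num)]
      norm_num
    calc t ^ ((1 : ℝ) / 4) ≤ ((7 / 8 : ℝ) ^ (4 : ℕ)) ^ ((1 : ℝ) / 4) :=
          Real.rpow_le_rpow ht0.le (ht1.trans (by norm_num)) (by norm_num)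
      _ = 7 / 8 := h78
  have hs34 : 0 ≤ s ^ ((3 : ℝ) / 4) := Real.rpow_nonneg hs _
  have h6 : n ^ ((3 : ℝ) / 4) * t ≤ 7 / 8 * s ^ ((3 : ℝ) / 4) := by
    rw [h4]
    calc s ^ ((3 : ℝ) / 4) * t ^ ((1 : ℝ) / 4) ≤ s ^ ((3 : ℝ) / 4) * (7 / 8) :=
          mul_le_mul_of_nonneg_left h5 hs34
      _ = 7 / 8 * s ^ ((3 : ℝ) / 4) := by ring
  have h7 : n ^ ((3 : ℝ) / 4) * (1 - t) = n ^ ((3 : ℝ) / 4) - n ^ ((3 : ℝ) / 4) * t := by ring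
  linarith

/-- **Transport from an invariant side of a re-matched host.**  `μ'` fixed-point-free involutions leaving `P`
invariant and agreeing with `μ` wherever `v` and `μ c v` are on the same side of `P`; `OGL` for the sub-host on `P`
(as permutations of `Fin |P|` via `P.equivFin`); budget `|R ∩ P| + |∂P| ≤ |P|^{3/4}`.  Then `OGL(n, μ, R)`: run the
sub-host's `OGL` with forbidden set (the preimage of) `(R ∩ P) ∪ ∂P`; the walk's points avoid `∂P`, where `μ' = μ`,
so its steps are `μ`-steps; all other clauses are transported along the injection `Fin |P| ↪ Fin n`, and
`|P|^{1/4} ≤ n^{1/4}`. [this line] -/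
theorem transport_side (n : ℕ) (μ μ' : Fin 3 → Equiv.Perm (Fin n)) (P R : Finset (Fin n))
    (hμ' : ∀ c, μ' c * μ' c = 1 ∧ ∀ v, μ' c v ≠ v)
    (hinv : ∀ c v, μ' c v ∈ P ↔ v ∈ P)
    (hagree : ∀ c v, (v ∈ P ↔ μ c v ∈ P) → μ' c v = μ c v)
    (hOGL : ∀ ν : Fin 3 → Equiv.Perm (Fin P.card), (∀ c, ν c * ν c = 1 ∧ ∀ v, ν c v ≠ v) →
      ∀ R' : Finset (Fin P.card), (R'.card : ℝ) ≤ (P.card : ℝ) ^ ((3 : ℝ) / 4) →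
      ∃ (k : ℕ) (p q : Fin (k + 1) → Fin P.card) (col : Fin (k + 1) → Fin 3), (∀ i, p i ≠ q i) ∧
        (∀ i, (ν (col i) (p i) = p (i + 1) ∧ ν (col i) (q i) = q (i + 1)) ∨
          (ν (col i) (p i) = q (i + 1) ∧ ν (col i) (q i) = p (i + 1))) ∧
        (∀ i, col i ≠ col (i + 1)) ∧
        (∀ i j, (p i = p j ∧ q i = q j) ∨ (p i = q j ∧ q i = p j) ∨
          (p i ≠ p j ∧ p i ≠ q j ∧ q i ≠ p j ∧ q i ≠ q j)) ∧
        (∀ i, p i ∉ R' ∧ q i ∉ R') ∧ ((k : ℝ) + 1) ≤ (P.card : ℝ) ^ ((1 : ℝ) / 4))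
    (hbudget : ((R ∩ P).card : ℝ) + ((P.filter fun v => ∃ c, μ c v ∉ P).card : ℝ)
      ≤ (P.card : ℝ) ^ ((3 : ℝ) / 4)) :
    ∃ (k : ℕ) (p q : Fin (k + 1) → Fin n) (col : Fin (k + 1) → Fin 3), (∀ i, p i ≠ q i) ∧
      (∀ i, (μ (col i) (p i) = p (i + 1) ∧ μ (col i) (q i) = q (i + 1)) ∨
        (μ (col i) (p i) = q (i + 1) ∧ μ (col i) (q i) = p (i + 1))) ∧
      (∀ i, col i ≠ col (i + 1)) ∧
      (∀ i j, (p i = p j ∧ q i = q j) ∨ (p i = q j ∧ q i = p j) ∨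
        (p i ≠ p j ∧ p i ≠ q j ∧ q i ≠ p j ∧ q i ≠ q j)) ∧
      (∀ i, p i ∉ R ∧ q i ∉ R) ∧ ((k : ℝ) + 1) ≤ (n : ℝ) ^ ((1 : ℝ) / 4) := by
  classical
  -- the sub-host on `P`, transported to `Fin |P|`
  set e : {v // v ∈ P} ≃ Fin P.card := P.equivFin with he
  set ν : Fin 3 → Equiv.Perm (Fin P.card) := fun c => e.permCongr ((μ' c).subtypePerm (hinv c)) with hν
  set f : Fin P.card → Fin n := fun x => ((e.symm x : {v // v ∈ P}) : Fin n) with hf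
  have hfP : ∀ x, f x ∈ P := fun x => (e.symm x).2
  have hf_inj : Function.Injective f := by
    intro x y h
    exact e.symm.injective (Subtype.ext h)
  have hfν : ∀ c x, f (ν c x) = μ' c (f x) := by
    intro c x
    simp [hf, hν, Equiv.permCongr_apply, Equiv.Perm.subtypePerm_apply]
  have hν_inv : ∀ c, ν c * ν c = 1 ∧ ∀ x, ν c x ≠ x := by
    intro c
    refine ⟨Equiv.ext fun x => hf_inj ?_, fun x hx => ?_⟩
    · rw [Equiv.Perm.mul_apply, hfν, hfν, ← Equiv.Perm.mul_apply, (hμ' c).1]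
      rfl
    · have h := congrArg f hx
      rw [hfν] at h
      exact (hμ' c).2 (f x) h
  -- the forbidden set of the sub-host: preimage of `(R ∩ P) ∪ ∂P`
  set Z := P.filter (fun v => ∃ c, μ c v ∉ P) with hZ
  set R' : Finset (Fin P.card) := Finset.univ.filter (fun x => f x ∈ R ∨ f x ∈ Z) with hR'
  have hR'card : (R'.card : ℝ) ≤ (P.card : ℝ) ^ ((3 : ℝ) / 4) := by
    have h1 : R'.card ≤ (R ∩ P).card + Z.card := by
      calc R'.card = (R'.image f).card := (Finset.card_image_of_injective _ hf_inj).symm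
        _ ≤ ((R ∩ P) ∪ Z).card := Finset.card_le_card ?_
        _ ≤ (R ∩ P).card + Z.card := Finset.card_union_le _ _
      intro v hv
      simp only [Finset.mem_image, hR', Finset.mem_filter, Finset.mem_univ, true_and] at hv
      obtain ⟨x, hx, rfl⟩ := hv
      rcases hx with h | h
      · exact Finset.mem_union_left _ (Finset.mem_inter.2 ⟨h, hfP x⟩)
      · exact Finset.mem_union_right _ h
    have h2 : (R'.card : ℝ) ≤ ((R ∩ P).card : ℝ) + (Z.card : ℝ) := by exact_mod_cast h1
    exact h2.trans hbudget
  obtain ⟨k, p', q', col, h1, h2, h3, h4, h5, h6⟩ := hOGL ν hν_inv R' hR'card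
  -- off the boundary layer `μ'` is `μ`
  have hagree' : ∀ c x, f x ∉ Z → μ' c (f x) = μ c (f x) := by
    intro c x hx
    apply hagree
    have hall : ∀ c', μ c' (f x) ∈ P := by
      by_contra hcon
      push Not at hcon
      exact hx (Finset.mem_filter.2 ⟨hfP x, hcon⟩)
    exact ⟨fun _ => hall c, fun _ => hfP x⟩
  have hpq : ∀ i, f (p' i) ∉ Z ∧ f (p' i) ∉ R ∧ f (q' i) ∉ Z ∧ f (q' i) ∉ R := by
    intro i
    have hp := (h5 i).1
    have hq := (h5 i).2
    simp only [hR', Finset.mem_filter, Finset.mem_univ, true_and, not_or] at hp hq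
    exact ⟨hp.2, hp.1, hq.2, hq.1⟩
  refine ⟨k, fun i => f (p' i), fun i => f (q' i), col, ?_, ?_, h3, ?_, ?_, ?_⟩
  · intro i h
    exact h1 i (hf_inj h)
  · intro i
    rcases h2 i with ⟨ha, hb⟩ | ⟨ha, hb⟩
    · left
      exact ⟨by rw [← hagree' _ _ (hpq i).1, ← hfν, ha], by rw [← hagree' _ _ (hpq i).2.2.1, ← hfν, hb]⟩
    · right
      exact ⟨by rw [← hagree' _ _ (hpq i).1, ← hfν, ha], by rw [← hagree' _ _ (hpq i).2.2.1, ← hfν, hb]⟩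
  · intro i j
    rcases h4 i j with ⟨ha, hb⟩ | ⟨ha, hb⟩ | ⟨ha, hb, hc, hd⟩
    · exact Or.inl ⟨congrArg f ha, congrArg f hb⟩
    · exact Or.inr (Or.inl ⟨congrArg f ha, congrArg f hb⟩)
    · exact Or.inr (Or.inr ⟨fun h => ha (hf_inj h), fun h => hb (hf_inj h),
        fun h => hc (hf_inj h), fun h => hd (hf_inj h)⟩)
  · intro i
    exact ⟨(hpq i).2.1, (hpq i).2.2.2⟩
  · have hsn : (P.card : ℝ) ≤ (n : ℝ) := by
      have h : P.card ≤ n := by simpa using P.card_le_univ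
      exact_mod_cast h
    exact h6.trans (Real.rpow_le_rpow (Nat.cast_nonneg _) hsn (by norm_num))

end SparseCut

/-- **Sparse cuts are recursible in the forbidden-set form of the one-gadget lemma.**  Let `μ c` be three
fixed-point-free involutions of `Fin n`, `R` a forbidden set with `|R| ≤ n^{3/4}`, and `S` a vertex set of EVEN size
`s` with `2s ≤ n` whose boundary layers `∂S = {v ∈ S : ∃ c, μ c v ∉ S}` and `∂Sᶜ` have at most `s^{3/4}/16` vertices each.
If the one-gadget statement `OGL` holds for every triple of fixed-point-free involutions on `|S|` and on `|Sᶜ|`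
points with every forbidden set of size `≤ |·|^{3/4}` (the strong-induction hypotheses), then `OGL(n, μ, R)`.
Proof: re-match both sides (`HyperoctahedralSubsets.stub_rematch`); if `|R ∩ S| + |∂S| ≤ s^{3/4}` transport from `S`,
else `|R ∩ S| > (15/16)s^{3/4}`, so `|R ∩ Sᶜ| + |∂Sᶜ| ≤ n^{3/4} − (7/8)s^{3/4} ≤ (n − s)^{3/4}` (`key_ineq`) and
transport from `Sᶜ`. [this line] -/
theorem sparseCut_oneGadget (n : ℕ) (μ : Fin 3 → Equiv.Perm (Fin n))
    (hμ : ∀ c, μ c * μ c = 1 ∧ ∀ v, μ c v ≠ v) (R S : Finset (Fin n))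
    (hR : (R.card : ℝ) ≤ (n : ℝ) ^ ((3 : ℝ) / 4)) (hSeven : Even S.card) (h2S : 2 * S.card ≤ n)
    (hZS : 16 * ((S.filter fun v => ∃ c, μ c v ∉ S).card : ℝ) ≤ (S.card : ℝ) ^ ((3 : ℝ) / 4))
    (hZT : 16 * ((Sᶜ.filter fun v => ∃ c, μ c v ∉ Sᶜ).card : ℝ) ≤ (S.card : ℝ) ^ ((3 : ℝ) / 4))
    (IH : ∀ P : Finset (Fin n), (P = S ∨ P = Sᶜ) →
      ∀ ν : Fin 3 → Equiv.Perm (Fin P.card), (∀ c, ν c * ν c = 1 ∧ ∀ v, ν c v ≠ v) →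
      ∀ R' : Finset (Fin P.card), (R'.card : ℝ) ≤ (P.card : ℝ) ^ ((3 : ℝ) / 4) →
      ∃ (k : ℕ) (p q : Fin (k + 1) → Fin P.card) (col : Fin (k + 1) → Fin 3), (∀ i, p i ≠ q i) ∧
        (∀ i, (ν (col i) (p i) = p (i + 1) ∧ ν (col i) (q i) = q (i + 1)) ∨
          (ν (col i) (p i) = q (i + 1) ∧ ν (col i) (q i) = p (i + 1))) ∧
        (∀ i, col i ≠ col (i + 1)) ∧
        (∀ i j, (p i = p j ∧ q i = q j) ∨ (p i = q j ∧ q i = p j) ∨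
          (p i ≠ p j ∧ p i ≠ q j ∧ q i ≠ p j ∧ q i ≠ q j)) ∧
        (∀ i, p i ∉ R' ∧ q i ∉ R') ∧ ((k : ℝ) + 1) ≤ (P.card : ℝ) ^ ((1 : ℝ) / 4)) :
    ∃ (k : ℕ) (p q : Fin (k + 1) → Fin n) (col : Fin (k + 1) → Fin 3), (∀ i, p i ≠ q i) ∧
      (∀ i, (μ (col i) (p i) = p (i + 1) ∧ μ (col i) (q i) = q (i + 1)) ∨
        (μ (col i) (p i) = q (i + 1) ∧ μ (col i) (q i) = p (i + 1))) ∧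
      (∀ i, col i ≠ col (i + 1)) ∧
      (∀ i j, (p i = p j ∧ q i = q j) ∨ (p i = q j ∧ q i = p j) ∨
        (p i ≠ p j ∧ p i ≠ q j ∧ q i ≠ p j ∧ q i ≠ q j)) ∧
      (∀ i, p i ∉ R ∧ q i ∉ R) ∧ ((k : ℝ) + 1) ≤ (n : ℝ) ^ ((1 : ℝ) / 4) := by
  classical
  obtain ⟨μ', hμ', hinv, hagree⟩ := HyperoctahedralSubsets.stub_rematch n μ hμ S hSeven
  by_cases hA : ((R ∩ S).card : ℝ) + ((S.filter fun v => ∃ c, μ c v ∉ S).card : ℝ)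
      ≤ (S.card : ℝ) ^ ((3 : ℝ) / 4)
  · exact SparseCut.transport_side n μ μ' S R hμ' hinv hagree (IH S (Or.inl rfl)) hA
  · -- use the complement
    have hinvT : ∀ c v, μ' c v ∈ Sᶜ ↔ v ∈ Sᶜ := fun c v => by
      simp only [Finset.mem_compl]
      exact not_congr (hinv c v)
    have hagreeT : ∀ c v, (v ∈ Sᶜ ↔ μ c v ∈ Sᶜ) → μ' c v = μ c v := fun c v h =>
      hagree c v (by simpa [Finset.mem_compl, not_iff_not] using h)
    apply SparseCut.transport_side n μ μ' Sᶜ R hμ' hinvT hagreeT (IH Sᶜ (Or.inr rfl))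
    push Not at hA
    have hcT : (Sᶜ.card : ℝ) = (n : ℝ) - (S.card : ℝ) := by
      rw [Finset.card_compl, Fintype.card_fin, Nat.cast_sub (by omega)]
    have hRT : ((R ∩ Sᶜ).card : ℝ) = (R.card : ℝ) - ((R ∩ S).card : ℝ) := by
      have h : (R \ S).card + (R ∩ S).card = R.card := Finset.card_sdiff_add_card_inter R S
      rw [Finset.sdiff_eq_inter_compl] at h
      have h' : ((R ∩ Sᶜ).card : ℝ) + ((R ∩ S).card : ℝ) = (R.card : ℝ) := by exact_mod_cast h
      linarith
    have key := SparseCut.key_ineq (s := (S.card : ℝ)) (n := (n : ℝ)) (Nat.cast_nonneg _)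
      (by exact_mod_cast h2S)
    rw [hcT, hRT]
    linarith

/-- **Registered form** (`stub_sparseCutOGL`, `--supports stmt-MatrixMultiplication-10883`): the statement of
`sparseCut_oneGadget` as one closed proposition — sparse even cuts are recursible in the forbidden-set form of the
one-gadget lemma. [this line] -/
theorem stub_sparseCutOGL : ∀ (n : ℕ) (μ : Fin 3 → Equiv.Perm (Fin n)), (∀ c, μ c * μ c = 1 ∧ ∀ v, μ c v ≠ v) → ∀ (R S : Finset (Fin n)), (R.card : ℝ) ≤ (n : ℝ) ^ ((3 : ℝ) / 4) → Even S.card → 2 * S.card ≤ n → 16 * ((S.filter fun v => ∃ c, μ c v ∉ S).card : ℝ) ≤ (S.card : ℝ) ^ ((3 : ℝ) / 4) → 16 * ((Sᶜ.filter fun v => ∃ c, μ c v ∉ Sᶜ).card : ℝ) ≤ (S.card : ℝ) ^ ((3 : ℝ) / 4) → (∀ P : Finset (Fin n), (P = S ∨ P = Sᶜ) → ∀ ν : Fin 3 → Equiv.Perm (Fin P.card), (∀ c, ν c * ν c = 1 ∧ ∀ v, ν c v ≠ v) → ∀ R' : Finset (Fin P.card), (R'.card : ℝ) ≤ (P.card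 : ℝ) ^ ((3 : ℝ) / 4) → ∃ (k : ℕ) (p q : Fin (k + 1) → Fin P.card) (col : Fin (k + 1) → Fin 3), (∀ i, p i ≠ q i) ∧ (∀ i, (ν (col i) (p i) = p (i + 1) ∧ ν (col i) (q i) = q (i + 1)) ∨ (ν (col i) (p i) = q (i + 1) ∧ ν (col i) (q i) = p (i + 1))) ∧ (∀ i, col i ≠ col (i + 1)) ∧ (∀ i j, (p i = p j ∧ q i = q j) ∨ (p i = q j ∧ q i = p j) ∨ (p i ≠ p j ∧ p i ≠ q j ∧ q i ≠ p j ∧ q i ≠ q j)) ∧ (∀ i, p i ∉ R' ∧ q i ∉ R') ∧ ((k : ℝ) + 1) ≤ (P.card : ℝ) ^ ((1 : ℝ) / 4)) → ∃ (k : ℕ) (p q : Fin (k + 1) → Fin n) (col : Fin (k + 1) → Fin 3), (∀ i, p i ≠ q i) ∧ (∀ i, (μ (col i) (p i) = p (i + 1) ∧ μ (col i) (q i) = q (i + 1)) ∨ (μ (col i) (p i) = q (i + 1) ∧ μ (col i) (q i) = p (i + 1))) ∧ (∀ i, col i ≠ col (i + 1)) ∧ (∀ i j, (p i = p j ∧ q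 i = q j) ∨ (p i = q j ∧ q i = p j) ∨ (p i ≠ p j ∧ p i ≠ q j ∧ q i ≠ p j ∧ q i ≠ q j)) ∧ (∀ i, p i ∉ R ∧ q i ∉ R) ∧ ((k : ℝ) + 1) ≤ (n : ℝ) ^ ((1 : ℝ) / 4) :=
  fun n μ hμ R S hR hSe h2S hZS hZT IH => sparseCut_oneGadget n μ hμ R S hR hSe h2S hZS hZT IH

end Summit.MatrixMultiplication.MatrixMultiplication.Theorems.HyperoctahedralThreshold
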